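import Literature.AnabelianGeometry.EtaleTheta.BiKummerThm44SubKummerClass
import Literature.AnabelianGeometry.EtaleTheta.BiKummerThm44SubModelBirat

/-!
# [EtTh] Thm 4.4 (iii), Kummer-class clause (T44-L16) AT THE MODEL INSTANCES `mkOfModel` / `mkOfModelCanonical`

S. Mochizuki, *The étale theta function …*, Publ. RIMS **45** (2009) [MochizukiEtTh2009], Thm 4.4 (iii) PDF p.94
(printed 320), last sentence: "Then the isomorphism `H¹(H_{A₁}, μ_N(A₁)) ⥲ H¹(H_{A₂}, μ_N(A₂))` maps `κ_{f₁} ↦ κ_{f₂}`"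
[cite: MochizukiEtTh2009, Thm 4.4 (iii) p.94].

Proof-only companion (no definitions) of `BiKummerThm44SubKummerClass.lean` (sub-DAG row T44-L16,
`Thm44Hyp.preservesKummerClass_of ⇐ {T44-L09c, T44-L10 (c)}`, abc-iut-L2-t3) and `BiKummerThm44SubModelBirat.lean`
(T44-L10 DISCHARGED at the model: `Thm44Hyp.biratCompatible_mkOfModel` with the CONSTRUCTED `ψ := psiModel`,
abc-iut-w5-d179): for the model instances of the §4 setting (`BiKummerSetting.mkOfModel`, abc-iut-L2-t9; the canonical
ones `mkOfModelCanonical` over the tree vocabularies) the Kummer-class clause holds with `ψ = Ψ^birat` CONSTRUCTED,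
modulo the single INPUT sub-node T44-L09c `GaloisCompatible` ([SemiAnbd] Prop 3.2 / Thm A.4 — a theorem over the
temperoid base, abc-iut-w5-d013, genuine-base version in flight) and print's standing hypotheses "`C_i` is a
Frobenioid" / T44-L03 (resp. Rmk 3.7.2 + `hBmon` at the canonical vocabularies, as in `thm44_ii_mkOfModelCanonical`).
Universe note: as in `BiKummerKummerClass.lean` (Mathlib `groupCohomology`), Hom- and monoid-universe `0`.
HONEST FRAMING: refereed pre-IUT material; nothing here bears on [IUTchIII] Cor. 3.12; a model instance is evidence
about OUR typed interface only.
-/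

noncomputable section

namespace Literature.AnabelianGeometry.EtaleTheta

open CategoryTheory Opposite Literature.AlgebraicGeometry.Frobenioids

namespace BiKummerSetting

universe u₀ v₀ u

variable {K : Type u₀} [Field K] {K' : Type u₀} [Field K'] {D₀ : Type u₀} [Category.{v₀} D₀]
  {X₁ : SemiGraphs.TemperedArithmeticGroup.{u₀} K} {X₂ : SemiGraphs.TemperedArithmeticGroup.{u₀} K'}
  {D₀' : Type u₀} [Category.{v₀} D₀'] {D₁ D₂ : Type u} [Category.{0} D₁] [Category.{0} D₂]

section Model

variable {V : FrdIMonoidStub.{0}} {T₁ : RealifiedDivisorMonoids (D₀ := D₀) V} {T₂ : RealifiedDivisorMonoids (D₀ := D₀') V}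
  {VD₁ : FrdICatStub.{u, 0, 0} D₁} {VD₂ : FrdICatStub.{u, 0, 0} D₂}
  {tf₁ : TemperedFrobenioid T₁ D₁ VD₁} {hZ₁ : tf₁.monoidType = MonoidType.Z}
  {hP₁ : ∀ A : D₁ᵒᵖ, IsPerfect (tf₁.Φ.carrier A)} {hBΛ₁ : ∀ (Y : D₀ᵒᵖ) (b : T₁.BΛ.obj Y), IsUnit b}
  {DS₁ : ∀ {A : D₁ᵒᵖ}, tf₁.Φ.carrier A → tf₁.Φ.carrier A → Prop} {IG₁ : D₁ → Prop}
  {gS₁ : ∀ A : D₁, IG₁ A → (X₁.Pi →* Aut A)} {gSs₁ : ∀ (A : D₁) (hA : IG₁ A), Function.Surjective (gS₁ A hA)}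
  {NH₁ : Subgroup (Field.absoluteGaloisGroup K) → tf₁.category → ℕ+ → Prop}
  {AB₁ : ∀ {A B : tf₁.category}, Subgroup (Aut A) → (A ⟶ A) → (A ⟶ B) → Prop} {A₀₁ : tf₁.category}
  {hA₀₁ : PreFrobenioid.IsFrobeniusTrivial tf₁.toElem A₀₁} {hA₀₁' : IG₁ A₀₁.base}
  {tf₂ : TemperedFrobenioid T₂ D₂ VD₂} {hZ₂ : tf₂.monoidType = MonoidType.Z}
  {hP₂ : ∀ A : D₂ᵒᵖ, IsPerfect (tf₂.Φ.carrier A)} {hBΛ₂ : ∀ (Y : D₀'ᵒᵖ) (b : T₂.BΛ.obj Y), IsUnit b}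
  {DS₂ : ∀ {A : D₂ᵒᵖ}, tf₂.Φ.carrier A → tf₂.Φ.carrier A → Prop} {IG₂ : D₂ → Prop}
  {gS₂ : ∀ A : D₂, IG₂ A → (X₂.Pi →* Aut A)} {gSs₂ : ∀ (A : D₂) (hA : IG₂ A), Function.Surjective (gS₂ A hA)}
  {NH₂ : Subgroup (Field.absoluteGaloisGroup K') → tf₂.category → ℕ+ → Prop}
  {AB₂ : ∀ {A B : tf₂.category}, Subgroup (Aut A) → (A ⟶ A) → (A ⟶ B) → Prop} {A₀₂ : tf₂.category}
  {hA₀₂ : PreFrobenioid.IsFrobeniusTrivial tf₂.toElem A₀₂} {hA₀₂' : IG₂ A₀₂.base}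

/-- **T44-L16 at the model instances `mkOfModel`, with `ψ = Ψ^birat` CONSTRUCTED (`psiModel`)**: the Kummer-class
clause of Thm 4.4 (iii) ⇐ {"`C_i` is a Frobenioid" ([FrdI] Thm 5.2 (ii)), T44-L03, T44-L09c} — T44-L10 (c) being the
theorem `biratCompatible_mkOfModel`. [cite: MochizukiEtTh2009, Thm 4.4 (iii) p.94] -/
theorem Thm44Hyp.preservesKummerClass_mkOfModel
    (h : Thm44Hyp (mkOfModel X₁ tf₁ hZ₁ hP₁ hBΛ₁ DS₁ IG₁ gS₁ gSs₁ NH₁ AB₁ A₀₁ hA₀₁ hA₀₁')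
      (mkOfModel X₂ tf₂ hZ₂ hP₂ hBΛ₂ DS₂ IG₂ gS₂ gSs₂ NH₂ AB₂ A₀₂ hA₀₂ hA₀₂'))
    (hF₁ : PreFrobenioid.IsFrobenioid tf₁.toElem) (hF₂ : PreFrobenioid.IsFrobenioid tf₂.toElem)
    (h3 : h.PreservesFrobeniusStructure) (h9 : h.GaloisCompatible) :
    h.PreservesKummerClass (h.psiModel hF₁ hF₂ h3) h9 (h.biratCompatible_mkOfModel hF₁ hF₂ h3) :=
  h.preservesKummerClass_of _ h9 _

/-- **Thm 4.4 (iii) IN FULL at the model instances `mkOfModel`** (saturation clause `Thm44_iii` and the Kummer-class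
clause) ⇐ {"`C₁, C₂` Frobenioids", T44-L03, the Frobenius-type clause of [FrdI] Thm 3.4 at `Ψ⁻¹`, T44-L15b, T44-L09c}.
[cite: MochizukiEtTh2009, Thm 4.4 (iii) p.94] -/
theorem Thm44Hyp.thm44_iii_and_kummerClass_mkOfModel
    (h : Thm44Hyp (mkOfModel X₁ tf₁ hZ₁ hP₁ hBΛ₁ DS₁ IG₁ gS₁ gSs₁ NH₁ AB₁ A₀₁ hA₀₁ hA₀₁')
      (mkOfModel X₂ tf₂ hZ₂ hP₂ hBΛ₂ DS₂ IG₂ gS₂ gSs₂ NH₂ AB₂ A₀₂ hA₀₂ hA₀₂'))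
    (hF₁ : PreFrobenioid.IsFrobenioid tf₁.toElem) (hF₂ : PreFrobenioid.IsFrobenioid tf₂.toElem)
    (h3 : h.PreservesFrobeniusStructure)
    (hrefl : ∀ ⦃A B : tf₁.category⦄ (φ : A ⟶ B),
      PreFrobenioid.IsFrobeniusType tf₂.toElem (h.Ψ.functor.map φ) → PreFrobenioid.IsFrobeniusType tf₁.toElem φ)
    (h15 : h.PreservesNHSaturatedBsFld) (h9 : h.GaloisCompatible) :
    Thm44_iii h (h.psiModel hF₁ hF₂ h3) ∧
      h.PreservesKummerClass (h.psiModel hF₁ hF₂ h3) h9 (h.biratCompatible_mkOfModel hF₁ hF₂ h3) :=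
  h.thm44_iii_and_kummerClass_of_inputs _ h3 hrefl hF₂ h15 h9 _

end Model

section Canonical

variable {T₁' : RealifiedDivisorMonoids (D₀ := D₀) treeMonoidVocab.{0}}
  {T₂' : RealifiedDivisorMonoids (D₀ := D₀') treeMonoidVocab.{0}}
  {IsRational₁ IsStrictlyRational₁ : (D₁ᵒᵖ ⥤ CommMonCat.{0}) → Prop}
  {IsRational₂ IsStrictlyRational₂ : (D₂ᵒᵖ ⥤ CommMonCat.{0}) → Prop}
  {tf₁ : TemperedFrobenioid T₁' D₁ (treeCatVocab D₁ IsRational₁ IsStrictlyRational₁)}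
  {hZ₁ : tf₁.monoidType = MonoidType.Z} {hP₁ : ∀ A : D₁ᵒᵖ, IsPerfect (tf₁.Φ.carrier A)}
  {IG₁ : D₁ → Prop} {gS₁ : ∀ A : D₁, IG₁ A → (X₁.Pi →* Aut A)}
  {gSs₁ : ∀ (A : D₁) (hA : IG₁ A), Function.Surjective (gS₁ A hA)}
  {NH₁ : Subgroup (Field.absoluteGaloisGroup K) → tf₁.category → ℕ+ → Prop} {A₀₁ : tf₁.category}
  {hA₀₁ : PreFrobenioid.IsFrobeniusTrivial tf₁.toElem A₀₁} {hA₀₁' : IG₁ A₀₁.base}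
  {tf₂ : TemperedFrobenioid T₂' D₂ (treeCatVocab D₂ IsRational₂ IsStrictlyRational₂)}
  {hZ₂ : tf₂.monoidType = MonoidType.Z} {hP₂ : ∀ A : D₂ᵒᵖ, IsPerfect (tf₂.Φ.carrier A)}
  {IG₂ : D₂ → Prop} {gS₂ : ∀ A : D₂, IG₂ A → (X₂.Pi →* Aut A)}
  {gSs₂ : ∀ (A : D₂) (hA : IG₂ A), Function.Surjective (gS₂ A hA)}
  {NH₂ : Subgroup (Field.absoluteGaloisGroup K') → tf₂.category → ℕ+ → Prop} {A₀₂ : tf₂.category}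
  {hA₀₂ : PreFrobenioid.IsFrobeniusTrivial tf₂.toElem A₀₂} {hA₀₂' : IG₂ A₀₂.base}

/-- **T44-L16 at the canonical model instances `mkOfModelCanonical`, with `ψ = Ψ^birat` CONSTRUCTED** ⇐
{Rmk 3.7.2 (`Remark372 D₀ / D₀'`), `hBmon₁ / hBmon₂`, T44-L09c} — "`C_i` Frobenioid" and T44-L03 being theorems at the
tree vocabularies (`isFrobenioid_treeCatVocab_of_isMonoidOn`, `preservesFrobeniusStructure_treeVocab`).
[cite: MochizukiEtTh2009, Thm 4.4 (iii) p.94] -/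
theorem Thm44Hyp.preservesKummerClass_mkOfModelCanonical
    (h : Thm44Hyp (mkOfModelCanonical X₁ tf₁ hZ₁ hP₁ IG₁ gS₁ gSs₁ NH₁ A₀₁ hA₀₁ hA₀₁')
      (mkOfModelCanonical X₂ tf₂ hZ₂ hP₂ IG₂ gS₂ gSs₂ NH₂ A₀₂ hA₀₂ hA₀₂'))
    (h372 : TemperedFrobenioid.Remark372 D₀) (h372' : TemperedFrobenioid.Remark372 D₀')
    (hBmon₁ : IsMonoidOn tf₁.ratFnFunctor) (hBmon₂ : IsMonoidOn tf₂.ratFnFunctor) (h9 : h.GaloisCompatible) :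
    h.PreservesKummerClass
      (h.psiModel (tf₁.isFrobenioid_treeCatVocab_of_isMonoidOn hBmon₁)
        (tf₂.isFrobenioid_treeCatVocab_of_isMonoidOn hBmon₂)
        (h.preservesFrobeniusStructure_treeVocab h372 h372' hBmon₁ hBmon₂)) h9
      (h.biratCompatible_mkOfModel (tf₁.isFrobenioid_treeCatVocab_of_isMonoidOn hBmon₁)
        (tf₂.isFrobenioid_treeCatVocab_of_isMonoidOn hBmon₂)
        (h.preservesFrobeniusStructure_treeVocab h372 h372' hBmon₁ hBmon₂)) :=
  h.preservesKummerClass_of _ h9 _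

end Canonical

end BiKummerSetting

end Literature.AnabelianGeometry.EtaleTheta

end
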